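import Literature.NumberTheory.EllipticCurves.KleinFrickeLevelTwentySeven
import Literature.NumberTheory.EllipticCurves.DivisionField
import HarnessLib

/-!
# The level-`9` Hauptmodul `η(E, C)` of a cyclic `9`-subgroup `C = ℤQ ⊂ E[9]` is an invariant of
# the set-wise stabiliser `Stab(C) ≤ Γ_ℚ`, lies in `ℚ(E[9])`, and satisfies
# `j(θ³ − 27) = θ³(θ³ − 24)³`, `A₁(3Q)³/A₃(3Q) = θ³` (`θ = η + 3`)
# (cell `b2b-bsdres`, team n1011, seat p02 gen 5 — row T-b11-F4, file F4c-H4 'Hauptmodul route,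
# curve side: the invariant'; the orbit argument of `exists_hauptmodul_nine_eq_of_torsion`, per `σ`)

HONEST FRAMING (cell `b2b-bsdres`, run/shared/lean/b2b/bsd-rank1-residual/, verbatim in every
file): the goal of the cell is to DELETE the COMBINATION-SHAPED residual classes of the
Birch–Swinnerton-Dyer formula for ALL analytic-rank `≤ 1` elliptic curves over `ℚ` — "full BSD
formula for every rank `≤ 1` curve in class `C`" assembled STRICTLY from published theorems — so
that the rank-`≤ 1` remainder becomes exactly the CONSTRUCTION-SHAPED classes, which are TYPED
(missing-input `Prop`s), NOT attempted. This is not "finishing BSD". Team n1011 (N10 / N11):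
research route; no claim beyond the stated classes; labels UNCHANGED; nothing is booked. Theorems
only (no definition, no named fact).

## What this file proves

* `hauptmodulNine_map_eq_of_smul_mem_zmultiples` (§1, any base field `F`, any `L/F`) — for
  `P = (x₀, y₀) ∈ E(L)` of order `9` and ONE `σ ∈ Aut(L/F)` with `σP ∈ ℤP`:
  `σ(η(f(P))) = η(f(P))`, `f` Kubert's coordinate (`WeierstrassCurve.tateNine`),
  `η(f) = (f³ − 6f² + 3f + 1)/(f(f − 1))` the level-`9` Hauptmodul.  This is the orbit argument of
  `Literature/…/KleinFrickeLevelTwentySeven.exists_hauptmodul_nine_eq_of_torsion` (where it is run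
  for all `σ` at once under a Galois-STABLE `ℤP`), per element: `σ f(P) = f(σP) ∈
  {f(P), f(2P), f(4P)}` (`f(−R) = f(R)`, `f(2R) = (f(R) − 1)/f(R)`) and `η` is invariant under the
  deck transformation (`hauptmodul_nine_eq_of_double`).
* **`exists_hauptmodulNine_invariant`** (§2, `E/ℚ`) — for a geometric point `Q` of order `9` with
  `3Q = T = (x₃, y₃)` there is `θ ∈ ℚ(E[9])` (`θ = η(E, ℤQ) + 3`) fixed by every `σ ∈ Γ_ℚ` with
  `σQ ∈ ℤQ`, with **`j(E)(θ³ − 27) = θ³(θ³ − 24)³`** (the level-`9` modular equation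
  `jη(η² + 9η + 27) = (η + 3)³(η³ + 9η² + 27η + 3)³` rewritten) and **`A₁(T)³/A₃(T) = θ³`**
  (`level_nine_three_smul` (T): the level-`3` Hauptmodul of `(E, ⟨T⟩)` is `η(η² + 9η + 27) + 27`).

With `HauptmodulThreeShapeValuation` (`v(A₁(T)³/A₃(T)) = v(3)` at `v₃(j − 1728) = 3`) and the
curve-free core `HauptmodulNineValuationFour` (`v₃(j) = 4` ⟹ `v(9θ²/(θ³ − 6)² − 1)⁹ = v(3)`), the
element `z = 9θ²/(θ³ − 6)² − 1 ∈ ℚ(E[9])` is a `Stab(ℤQ)`-invariant of `3`-adic valuation `1/9` —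
the input of the scalar-stabiliser tower criterion (F4a/F4b).  Nothing booked.

References: [Maier2006] R. S. Maier, J. Ramanujan Math. Soc. 24 (2009), Table 4 (N = 9), §5;
[Kubert1976] Table 3.
-/

noncomputable section

open scoped Classical

open WeierstrassCurve Field

-- pin `Algebra ℚ ℚ̄` as in `GaloisImage/ThreeAdicTowerInertiaCriterion` (the `Γ_ℚ`-action on
-- `E(ℚ̄) = (W.baseChange ℚ̄).Point` and `W.geomPoints` must see the same instance)
attribute [local instance 1001] IntermediateField.algebra'
attribute [local instance 1002] AlgebraicClosure.instAlgebra

universe u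

namespace Summit.BirchSwinnertonDyer.Rank1Residual.GaloisImage

open Literature.NumberTheory.EllipticCurves Literature.NumberTheory.GaloisRepresentations

/-! ### §1 The orbit argument, per element -/

section Orbit

variable {F : Type u} [Field F] {W : WeierstrassCurve F} {L : Type u} [Field L] [Algebra F L]

/-- **`η(E, ℤP)` is fixed by every `σ` with `σP ∈ ℤP`.**  Let `P = (x₀, y₀) ∈ E(L)` have order
`9`, `f = f(P)` Kubert's coordinate and `σ ∈ Aut(L/F)` with `σP ∈ ℤP`.  Then
`σ(η(f)) = η(f)` for `η(f) = (f³ − 6f² + 3f + 1)/(f(f − 1))`: `σ f(P) = f(σP)` with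
`σP ∈ {±P, ±2P, ±4P}` (the other multiples have the wrong order), `f(−R) = f(R)`,
`f(2P) = (f − 1)/f`, `f(4P) = −1/(f − 1)`, and `η` is invariant under `f ↦ (f − 1)/f`.
[cite: Maier2006, Table 4 (N = 9)] -/
theorem hauptmodulNine_map_eq_of_smul_mem_zmultiples [W.IsElliptic] {x₀ y₀ : L}
    {h : (W.baseChange L).toAffine.Nonsingular x₀ y₀}
    (h9 : addOrderOf (Affine.Point.some _ _ h : (W.baseChange L).toAffine.Point) = 9)
    (σ : L ≃ₐ[F] L)
    (hσ : σ • (Affine.Point.some _ _ h : (W.baseChange L).toAffine.Point) ∈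
      AddSubgroup.zmultiples (Affine.Point.some _ _ h : (W.baseChange L).toAffine.Point)) :
    σ (((W.baseChange L).tateNine x₀ y₀ ^ 3 - 6 * (W.baseChange L).tateNine x₀ y₀ ^ 2 +
            3 * (W.baseChange L).tateNine x₀ y₀ + 1) /
          ((W.baseChange L).tateNine x₀ y₀ * ((W.baseChange L).tateNine x₀ y₀ - 1))) =
      ((W.baseChange L).tateNine x₀ y₀ ^ 3 - 6 * (W.baseChange L).tateNine x₀ y₀ ^ 2 +
            3 * (W.baseChange L).tateNine x₀ y₀ + 1) /
          ((W.baseChange L).tateNine x₀ y₀ * ((W.baseChange L).tateNine x₀ y₀ - 1)) := by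
  -- adapted from `Literature/…/KleinFrickeLevelTwentySeven.exists_hauptmodul_nine_eq_of_torsion`
  obtain ⟨P, hP⟩ : ∃ P : (W.baseChange L).toAffine.Point, P = Affine.Point.some _ _ h := ⟨_, rfl⟩
  rw [← hP] at h9 hσ
  haveI : (W.baseChange L).IsElliptic := by rw [baseChange]; infer_instance
  -- order bookkeeping
  have h9P : (9 : ℕ) • P = 0 := h9 ▸ addOrderOf_nsmul_eq_zero P
  have hmul : ∀ k : ℕ, k • P = 0 → 9 ∣ k := fun k hk => h9 ▸ addOrderOf_dvd_of_nsmul_eq_zero hk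
  have hP0 : P ≠ 0 := fun e => by have := hmul 1 (by rw [one_nsmul, e]); omega
  have h2P : (2 : ℕ) • P ≠ 0 := fun e => by have := hmul 2 e; omega
  have h3P : (3 : ℕ) • P ≠ 0 := fun e => by have := hmul 3 e; omega
  have h4P : (4 : ℕ) • P ≠ 0 := fun e => by have := hmul 4 e; omega
  have h8P : (8 : ℕ) • P ≠ 0 := fun e => by have := hmul 8 e; omega
  subst hP
  -- `2P = (x₁, y₁)` and `4P = (x₂, y₂)` are affine
  obtain ⟨x₁, y₁, h₁, hQ⟩ : ∃ x₁ y₁ h₁, (Affine.Point.some _ _ h : (W.baseChange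
      L).toAffine.Point) + .some _ _ h = .some x₁ y₁ h₁ := by
    rcases hPP : (Affine.Point.some _ _ h : (W.baseChange L).toAffine.Point) + .some _ _ h with
        _ | ⟨x₁, y₁, h₁⟩
    · exact absurd (by rw [two_nsmul, hPP, ← Affine.Point.zero_def]) h2P
    · exact ⟨x₁, y₁, h₁, hPP⟩
  have e4 : (4 : ℕ) • (Affine.Point.some _ _ h : (W.baseChange L).toAffine.Point) =
      (.some _ _ h + .some _ _ h) + (.some _ _ h + .some _ _ h) := by
    abel
  obtain ⟨x₂, y₂, h₂, hR⟩ : ∃ x₂ y₂ h₂, (Affine.Point.some _ _ h₁ : (W.baseChange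
      L).toAffine.Point) + .some _ _ h₁ = .some x₂ y₂ h₂ := by
    rcases hQQ : (Affine.Point.some _ _ h₁ : (W.baseChange L).toAffine.Point) + .some _ _ h₁ with
        _ | ⟨x₂, y₂, h₂⟩
    · exact absurd (by rw [e4, hQ, hQQ, ← Affine.Point.zero_def]) h4P
    · exact ⟨x₂, y₂, h₂, hQQ⟩
  -- `P ≠ -P`, `2P ≠ -2P`, `4P ≠ -4P`
  have hy : y₀ ≠ (W.baseChange L).toAffine.negY x₀ y₀ := fun hyy =>
    h2P (by rw [two_nsmul]; exact Affine.Point.add_self_of_Y_eq hyy)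
  have hy₁ : y₁ ≠ (W.baseChange L).toAffine.negY x₁ y₁ := fun hyy =>
    h4P (by rw [e4, hQ]; exact Affine.Point.add_self_of_Y_eq hyy)
  have e8 : (8 : ℕ) • (Affine.Point.some _ _ h : (W.baseChange L).toAffine.Point) =
      ((.some _ _ h + .some _ _ h) + (.some _ _ h + .some _ _ h)) +
        ((.some _ _ h + .some _ _ h) + (.some _ _ h + .some _ _ h)) := by
    abel
  have hy₂ : y₂ ≠ (W.baseChange L).toAffine.negY x₂ y₂ := fun hyy =>
    h8P (by rw [e8, hQ, hR]; exact Affine.Point.add_self_of_Y_eq hyy)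
  -- Kubert's coordinate at `P` (`f₀`), `2P` (`f₁ = (f₀-1)/f₀`) and `4P` (`f₂ = (f₁-1)/f₁`)
  have h9Q : (9 : ℕ) • (Affine.Point.some _ _ h₁ : (W.baseChange L).toAffine.Point) = 0 := by
    rw [← hQ, nsmul_add, h9P, add_zero]
  have h3Q : (3 : ℕ) • (Affine.Point.some _ _ h₁ : (W.baseChange L).toAffine.Point) ≠ 0 := by
    rw [← hQ]
    intro e
    have e' : (6 : ℕ) • (Affine.Point.some _ _ h : (W.baseChange L).toAffine.Point) = 0 := by
      rw [← e]
      abel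
    have := hmul 6 e'
    omega
  obtain ⟨hf0, hf1, hq, hfQ, hD, hj⟩ :=
    tateNine_of_order_nine (V := W.baseChange L) h9P h3P hQ
  obtain ⟨hf0', hf1', -, hfR, -, -⟩ :=
    tateNine_of_order_nine (V := W.baseChange L) h9Q h3Q hR
  -- Galois moves `f(P)` within `{f₀, f₁, f₂}`
  have hT :
      σ ((W.baseChange L).tateNine x₀ y₀) = (W.baseChange L).tateNine x₀ y₀ ∨
      σ ((W.baseChange L).tateNine x₀ y₀) = (W.baseChange L).tateNine x₁ y₁ ∨
      σ ((W.baseChange L).tateNine x₀ y₀) = (W.baseChange L).tateNine x₂ y₂ := by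
    have key := map_tateNine (W := W) (σ : L →ₐ[F] L) x₀ y₀
    rw [AlgEquiv.coe_toAlgHom] at key
    rw [key]
    -- `σP = mP`, `m = n mod 9 ∈ {0, …, 8}`
    obtain ⟨n, hn⟩ := AddSubgroup.mem_zmultiples_iff.mp hσ
    have hmod := mod_addOrderOf_zsmul
      (Affine.Point.some _ _ h : (W.baseChange L).toAffine.Point) n
    rw [h9, hn] at hmod
    push_cast at hmod
    have h0n : 0 ≤ n % 9 := Int.emod_nonneg _ (by norm_num)
    have h9n : n % 9 < 9 := Int.emod_lt_of_pos _ (by norm_num)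
    -- coordinates of `σP` from an equation `σP = (x', y')`
    have coords : ∀ {x' y' : L} {h' : (W.baseChange L).toAffine.Nonsingular x' y'},
        σ • (Affine.Point.some _ _ h : (W.baseChange L).toAffine.Point) = .some _ _ h' →
          σ x₀ = x' ∧ σ y₀ = y' := by
      intro x' y' h' hσP
      change Affine.Point.map (σ : L →ₐ[F] L) (Affine.Point.some _ _ h) = _ at hσP
      rw [Affine.Point.map_some] at hσP
      simpa only [Affine.Point.some.injEq, AlgEquiv.coe_toAlgHom] using hσP
    have e1 := map_nsmul (DistribSMul.toAddMonoidHom _ σ) 3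
      (Affine.Point.some _ _ h : (W.baseChange L).toAffine.Point)
    simp only [DistribSMul.toAddMonoidHom_apply] at e1
    generalize n % 9 = m at hmod h0n h9n
    interval_cases m
    · -- `σP = O`: impossible
      rw [zero_zsmul] at hmod
      exact absurd ((smul_eq_zero_iff_eq σ).mp hmod.symm) (Affine.Point.some_ne_zero h)
    · -- `σP = P`
      rw [one_zsmul] at hmod
      obtain ⟨hx, hy'⟩ := coords hmod.symm
      exact Or.inl (by rw [hx, hy'])
    · -- `σP = 2P`
      rw [two_zsmul, hQ] at hmod
      obtain ⟨hx, hy'⟩ := coords hmod.symm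
      exact Or.inr (Or.inl (by rw [hx, hy']))
    · -- `σP = 3P`: then `σ(3P) = 9P = O`, impossible
      rw [ofNat_zsmul] at hmod
      refine (h3P ((smul_eq_zero_iff_eq σ).mp ?_)).elim
      rw [e1, ← hmod, smul_smul]
      exact h9P
    · -- `σP = 4P`
      rw [ofNat_zsmul, e4, hQ, hR] at hmod
      obtain ⟨hx, hy'⟩ := coords hmod.symm
      exact Or.inr (Or.inr (by rw [hx, hy']))
    · -- `σP = 5P = -4P`
      have e5 : (5 : ℕ) • (Affine.Point.some _ _ h : (W.baseChange L).toAffine.Point) =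
          -.some _ _ h₂ := by
        rw [eq_neg_iff_add_eq_zero, ← hR, ← hQ, ← e4, ← add_nsmul]
        exact h9P
      rw [ofNat_zsmul, e5, Affine.Point.neg_some] at hmod
      obtain ⟨hx, hy'⟩ := coords hmod.symm
      exact Or.inr (Or.inr (by rw [hx, hy', tateNine_negY hy₂]))
    · -- `σP = 6P`: then `σ(3P) = 18P = O`, impossible
      rw [ofNat_zsmul] at hmod
      refine (h3P ((smul_eq_zero_iff_eq σ).mp ?_)).elim
      rw [e1, ← hmod, smul_smul, show (3 * 6 : ℕ) = 9 + 9 from rfl, add_nsmul, h9P, add_zero]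
    · -- `σP = 7P = -2P`
      have e7 : (7 : ℕ) • (Affine.Point.some _ _ h : (W.baseChange L).toAffine.Point) =
          -.some _ _ h₁ := by
        rw [eq_neg_iff_add_eq_zero, ← hQ, ← two_nsmul, ← add_nsmul]
        exact h9P
      rw [ofNat_zsmul, e7, Affine.Point.neg_some] at hmod
      obtain ⟨hx, hy'⟩ := coords hmod.symm
      exact Or.inr (Or.inl (by rw [hx, hy', tateNine_negY hy₁]))
    · -- `σP = 8P = -P`
      have e8' : (8 : ℕ) • (Affine.Point.some _ _ h : (W.baseChange L).toAffine.Point) =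
          -.some _ _ h := by
        rw [eq_neg_iff_add_eq_zero, ← succ_nsmul]
        exact h9P
      rw [ofNat_zsmul, e8', Affine.Point.neg_some] at hmod
      obtain ⟨hx, hy'⟩ := coords hmod.symm
      exact Or.inl (by rw [hx, hy', tateNine_negY hy])
  -- hence `η` is fixed by `σ`
  revert hf0 hf1 hq hfQ hD hj hf0' hf1' hfR hT
  generalize (W.baseChange L).tateNine x₀ y₀ = u
  generalize (W.baseChange L).tateNine x₁ y₁ = v
  generalize (W.baseChange L).tateNine x₂ y₂ = w
  intro hf0 hf1 _ hfQ _ _ hf0' hf1' hfR hT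
  simp only [map_div₀, map_mul, map_add, map_sub, map_pow, map_one, map_ofNat]
  rcases hT with e | e | e
  · rw [e]
  · rw [e, hfQ]
    exact hauptmodul_nine_eq_of_double hf0 hf1
  · rw [e, hfR, hauptmodul_nine_eq_of_double hf0' hf1', hfQ]
    exact hauptmodul_nine_eq_of_double hf0 hf1

end Orbit

/-! ### §2 On `E/ℚ`: the invariant `θ = η + 3` of a cyclic `9`-subgroup -/

section Rational

variable (W : WeierstrassCurve ℚ) [W.IsElliptic]

/-- **The `Stab(ℤQ)`-invariant `θ`.**  Let `Q ∈ E(ℚ̄)` have order `9` and `3Q = T = (x₃, y₃)`.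
Then there is `θ ∈ ℚ(E[9])` (namely `θ = η(f(Q)) + 3`) with `σθ = θ` for every `σ ∈ Γ_ℚ` with
`σQ ∈ ℤQ`, `j(E)(θ³ − 27) = θ³(θ³ − 24)³` and `A₁(T)³/A₃(T) = θ³` (on `E ⊗ ℚ̄`).
[cite: Maier2006, Table 4 (N = 9) and §5] -/
theorem exists_hauptmodulNine_invariant {Q : W.geomPoints} (h9 : addOrderOf Q = 9)
    {x₃ y₃ : AlgebraicClosure ℚ}
    {h₃ : (W.map (algebraMap ℚ (AlgebraicClosure ℚ))).toAffine.Nonsingular x₃ y₃}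
    (hT : (3 : ℤ) • Q = (Affine.Point.some x₃ y₃ h₃ :
      (W.map (algebraMap ℚ (AlgebraicClosure ℚ))).toAffine.Point)) :
    ∃ θ : AlgebraicClosure ℚ, θ ∈ W.divisionField 9 ∧
      (∀ σ : absoluteGaloisGroup ℚ, (∃ k : ℤ, σ • Q = k • Q) → σ • θ = θ) ∧
      algebraMap ℚ (AlgebraicClosure ℚ) W.j * (θ ^ 3 - 27) = θ ^ 3 * (θ ^ 3 - 24) ^ 3 ∧
      (W.map (algebraMap ℚ (AlgebraicClosure ℚ))).tgA₁ x₃ y₃ ^ 3 /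
          (W.map (algebraMap ℚ (AlgebraicClosure ℚ))).tgA₃ x₃ y₃ = θ ^ 3 := by
  haveI : (W.map (algebraMap ℚ (AlgebraicClosure ℚ))).IsElliptic := inferInstance
  -- `Q` as a point of `E ⊗ ℚ̄`
  obtain ⟨P, hP⟩ : ∃ P : (W.map (algebraMap ℚ (AlgebraicClosure ℚ))).toAffine.Point, P = Q :=
    ⟨_, rfl⟩
  have h9P : (9 : ℕ) • P = 0 := by rw [hP]; exact h9 ▸ addOrderOf_nsmul_eq_zero Q
  have hmul : ∀ k : ℕ, k • P = 0 → 9 ∣ k := fun k hk =>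
    h9 ▸ addOrderOf_dvd_of_nsmul_eq_zero (show k • Q = 0 by rw [← hP]; exact hk)
  have hP0 : P ≠ 0 := fun e => by have := hmul 1 (by rw [one_nsmul, e]); omega
  have h2P : (2 : ℕ) • P ≠ 0 := fun e => by have := hmul 2 e; omega
  have h3P : (3 : ℕ) • P ≠ 0 := fun e => by have := hmul 3 e; omega
  rcases hPxy : P with _ | ⟨x₀, y₀, h₀⟩
  · exact absurd hPxy hP0
  rw [hPxy] at h9P h2P h3P hP
  have h9' : addOrderOf (Affine.Point.some x₀ y₀ h₀ :
      (W.map (algebraMap ℚ (AlgebraicClosure ℚ))).toAffine.Point) = 9 := by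
    rw [hP]; exact h9
  -- `2Q = (x₁, y₁)` is affine
  obtain ⟨x₁, y₁, h₁, hQQ⟩ : ∃ x₁ y₁ h₁, (Affine.Point.some _ _ h₀ :
      (W.map (algebraMap ℚ (AlgebraicClosure ℚ))).toAffine.Point) + .some _ _ h₀ =
        .some x₁ y₁ h₁ := by
    rcases hPP : (Affine.Point.some _ _ h₀ :
        (W.map (algebraMap ℚ (AlgebraicClosure ℚ))).toAffine.Point) + .some _ _ h₀ with
        _ | ⟨x₁, y₁, h₁⟩
    · exact absurd (by rw [two_nsmul, hPP, ← Affine.Point.zero_def]) h2P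
    · exact ⟨x₁, y₁, h₁, hPP⟩
  -- Kubert's coordinate and the level-`9` modular equation
  obtain ⟨hf0, hf1, hq, -, hD, hj⟩ :=
    tateNine_of_order_nine (V := W.map (algebraMap ℚ (AlgebraicClosure ℚ))) h9P h3P hQQ
  obtain ⟨-, hjH⟩ := j_mul_hauptmodul_nine hf0 hf1 hq hD hj
  -- the level-`3` Hauptmodul of `⟨3Q⟩`
  have hT' : (Affine.Point.some _ _ h₀ : (W.map (algebraMap ℚ (AlgebraicClosure ℚ))).toAffine.Point)
      + (.some _ _ h₀ + .some _ _ h₀) = .some x₃ y₃ h₃ := by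
    rw [← hT, ← hP]
    have e : (Affine.Point.some _ _ h₀ : (W.map (algebraMap ℚ (AlgebraicClosure ℚ))).toAffine.Point)
        + (.some _ _ h₀ + .some _ _ h₀) = (3 : ℕ) • Affine.Point.some _ _ h₀ := by abel
    rw [e, ← natCast_zsmul]
    rfl
  obtain ⟨⟨-, hS⟩, -, -⟩ := level_nine_three_smul (V := W.map (algebraMap ℚ (AlgebraicClosure ℚ)))
    h9P h3P hT' rfl rfl rfl
  -- `η` is fixed by every `σ` with `σQ ∈ ℤQ` (§1 with `σ` read in `Aut(ℚ̄/ℚ)`)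
  have hfix : ∀ σ : absoluteGaloisGroup ℚ, (∃ k : ℤ, σ • Q = k • Q) →
      σ • (((W.map (algebraMap ℚ (AlgebraicClosure ℚ))).tateNine x₀ y₀ ^ 3 -
              6 * (W.map (algebraMap ℚ (AlgebraicClosure ℚ))).tateNine x₀ y₀ ^ 2 +
              3 * (W.map (algebraMap ℚ (AlgebraicClosure ℚ))).tateNine x₀ y₀ + 1) /
            ((W.map (algebraMap ℚ (AlgebraicClosure ℚ))).tateNine x₀ y₀ *
              ((W.map (algebraMap ℚ (AlgebraicClosure ℚ))).tateNine x₀ y₀ - 1))) =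
        ((W.map (algebraMap ℚ (AlgebraicClosure ℚ))).tateNine x₀ y₀ ^ 3 -
              6 * (W.map (algebraMap ℚ (AlgebraicClosure ℚ))).tateNine x₀ y₀ ^ 2 +
              3 * (W.map (algebraMap ℚ (AlgebraicClosure ℚ))).tateNine x₀ y₀ + 1) /
            ((W.map (algebraMap ℚ (AlgebraicClosure ℚ))).tateNine x₀ y₀ *
              ((W.map (algebraMap ℚ (AlgebraicClosure ℚ))).tateNine x₀ y₀ - 1)) := by
    rintro σ ⟨k, hk⟩
    have hmem : absoluteGaloisGroup.toAlgEquiv ℚ σ • (Affine.Point.some x₀ y₀ h₀ :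
        (W.baseChange (AlgebraicClosure ℚ)).toAffine.Point) ∈
        AddSubgroup.zmultiples (Affine.Point.some x₀ y₀ h₀ :
          (W.baseChange (AlgebraicClosure ℚ)).toAffine.Point) := by
      refine AddSubgroup.mem_zmultiples_iff.mpr ⟨k, ?_⟩
      have e : σ • Q = k • Q := hk
      rw [← hP] at e
      exact e.symm
    rw [absoluteGaloisGroup.smul_def]
    exact hauptmodulNine_map_eq_of_smul_mem_zmultiples (W := W) (L := AlgebraicClosure ℚ) h9'
      (absoluteGaloisGroup.toAlgEquiv ℚ σ) hmem
  revert hf0 hf1 hq hD hj hjH hS hfix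
  generalize (W.map (algebraMap ℚ (AlgebraicClosure ℚ))).tateNine x₀ y₀ = f
  intro hf0 hf1 _ _ _ hjH hS hfix
  refine ⟨(f ^ 3 - 6 * f ^ 2 + 3 * f + 1) / (f * (f - 1)) + 3, ?_, ?_, ?_, ?_⟩
  · -- `θ ∈ ℚ(E[9])`: an element fixing `E[9]` pointwise fixes `Q`
    have hQ9 : Q ∈ geomTorsion W 9 := by
      refine (Submodule.mem_torsionBy_iff _ _).mpr ?_
      rw [← hP, show (9 : ℤ) = ((9 : ℕ) : ℤ) from rfl, natCast_zsmul]
      exact h9P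
    refine (W.mem_divisionField_iff 9).mpr fun σ hσ => ?_
    have hQfix : σ • Q = Q := by
      have := congrArg (fun T : geomTorsion W 9 => (T : W.geomPoints)) (hσ ⟨Q, hQ9⟩)
      simpa only [AddSubgroup.torsionBy.coe_smul] using this
    rw [smul_add, hfix σ ⟨1, by rw [one_zsmul]; exact hQfix⟩, absoluteGaloisGroup.smul_def,
      map_ofNat]
  · intro σ hσQ
    rw [smul_add, hfix σ hσQ, absoluteGaloisGroup.smul_def, map_ofNat]
  · have hjL : algebraMap ℚ (AlgebraicClosure ℚ) W.j =
        (W.map (algebraMap ℚ (AlgebraicClosure ℚ))).j := (W.map_j _).symm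
    rw [hjL]
    linear_combination hjH
  · linear_combination hS

end Rational

end Summit.BirchSwinnertonDyer.Rank1Residual.GaloisImage
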